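import Summits.NavierStokesRegularity.FluidComputer.PalasekTowerRegisterWindowTuned

/-!
# The RE-TIMED window schedule: an UNFORCED rigid schedule reading level `0` at an ARBITRARY time `τ₀ > 0`

Cell `ns-blowup`, seat `ns-blowup-ecbridge-3` (g10; D-0074 GROUP C «BRIDGE SUPPORT», lineage
`host_preparation`; bears_on LADDER-NS N1, route `PalasekTowerBreakdown` rev 19, crux `EpisodeBaseT` =
item stmt-NavierStokesRegularity-20303, crux-strategist line «robustmirror», stub T2 `ShadowRegistersT`).
LABEL: E–C typing (KERNEL vocabulary: one schedule constructor + its register clauses; no named fact,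
no `sorry`). WHAT THIS IS NOT: not Navier–Stokes evidence — a bookkeeping object (datum, zero force,
readout clock); it carries no stage and says nothing about dynamics.

## Why

Every schedule constructor in the tree (`Schedule.ofWindows`, `Schedule.ofBox`, `Schedule.ofBoxAt`,
`Host.hostSchedule`, the germ hosts) reads level `0` at the FIXED time `τ₀ = 1`: the level-`0` host is
prepared by a force and the clock is the designer's. The SHADOW (re-timing) lemma of the line «robustmirror»
(`Cruxes/EpisodeBaseT/Lines/robustmirror.lean`, T2) registers UNFORCED designs whose free run reaches the
level-`0` floor BY ITSELF, at its own first hitting time — which moves with the datum. This file supplies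
the `τ₀`-generic twin of `Schedule.ofBoxAt`:

* `Schedule.ofWindowsFrom R c₃ r … τ₀ hτ₀ a ha ρ` — readouts `τ_k = τ₀ + Σ_{j<k} w_j`
  (`w_k = 4bβ log N_{k+1}/A_k = R.window k`), blow-up time `T = τ₀ + Σ_k w_k`, registered constants
  `c₁ = 1`, `c₂ = 5/3`, `c₅ = 4bβ`, push constant `c₄ = 0`, the clock witness `c₃`, radius `ρ`, DATUM `a`
  (any rapidly decaying field) and the ZERO force; hypotheses = the register numerics of `R`
  (`w_{k+1} ≤ r w_k`, `A_k w_{k+1} ≤ (1 − r) c₃`, `2Y₀ ≤ Y₁`), exactly as for `Schedule.ofWindows`;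
* field lemmas (`ofWindowsFrom_τ`, `_τ_zero`, `_τ_one`, `_T`, `_f`, `_u₀`, `_radius`, `_c₁`, `_c₂`, `_c₄`,
  `_c₅`), and the schedule-level register clauses: `ofWindowsFrom_rigid`, `ofWindowsFrom_quiet`,
  `ofWindowsFrom_pins` (`Pins Λ (6/5)` for EVERY `Λ` once the datum is confined to `B̄(0, ρ)` and the
  rates afford `2Y_k ≤ Y_{k+1}` — the force is zero, so the impulse pin is free);
* `ofWindowsFrom_τ_one_sub_window` — the quiet read-back time `τ₁ − c₅ log N₁ / A₀` IS `τ₀`.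

References: S. Palasek, arXiv:2605.13827 §3.3 (trapping region, schedule) [cite: Palasek2026ElementaryModel, §3.3].
-/

noncomputable section

namespace Summit.NavierStokesRegularity.FluidComputer.PalasekTowerClayBridge

open Set MeasureTheory Filter Topology Function
open scoped ENNReal ContDiff NNReal
open Literature.Analysis.FluidPDE

namespace Schedule

/-! ## §1 The re-timed readout clock -/

section Clock

variable (R : TowerRates) (τ₀ : ℝ)

/-- The readout times of the re-timed window schedule: `τ_k = τ₀ + Σ_{j<k} w_j`. [folklore] -/
def windowTimeFrom (k : ℕ) : ℝ := τ₀ + ∑ j ∈ Finset.range k, R.window j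

/-- `τ_0 = τ₀`. [folklore] -/
theorem windowTimeFrom_zero : windowTimeFrom R τ₀ 0 = τ₀ := by
  simp [windowTimeFrom]

/-- `τ_{k+1} = τ_k + w_k`. [folklore] -/
theorem windowTimeFrom_succ (k : ℕ) :
    windowTimeFrom R τ₀ (k + 1) = windowTimeFrom R τ₀ k + R.window k := by
  simp [windowTimeFrom, Finset.sum_range_succ, add_assoc]

/-- `τ_1 = τ₀ + w_0`. [folklore] -/
theorem windowTimeFrom_one : windowTimeFrom R τ₀ 1 = τ₀ + R.window 0 := by
  rw [windowTimeFrom_succ, windowTimeFrom_zero]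

/-- The re-timed clock is the `τ₀ = 1` clock shifted by `τ₀ − 1`. [folklore] -/
theorem windowTimeFrom_eq (k : ℕ) : windowTimeFrom R τ₀ k = windowTime R k + (τ₀ - 1) := by
  simp only [windowTimeFrom, windowTime]
  ring

/-- The re-timed readouts are monotone in the level. [folklore] -/
theorem windowTimeFrom_mono : Monotone (windowTimeFrom R τ₀) := by
  refine monotone_nat_of_le_succ fun k => ?_
  rw [windowTimeFrom_succ]
  have := R.window_pos k
  linarith

variable {R} {c₃ r : ℝ}

/-- Every re-timed readout lies strictly before the re-timed blow-up time `T = τ₀ + Σ_k w_k`, under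
geometric domination of the windows. [folklore] -/
theorem windowTimeFrom_lt_T_of_geo (hr0 : 0 ≤ r) (hr1 : r < 1)
    (hgeo : ∀ k, R.window (k + 1) ≤ r * R.window k) (k : ℕ) :
    windowTimeFrom R τ₀ k < τ₀ + ∑' j, R.window j := by
  have hs := (window_tail_le hr0 hr1 hgeo 0).1
  simp only [add_zero] at hs
  have hsplit := hs.sum_add_tsum_nat_add k
  have htail := (window_tail_le hr0 hr1 hgeo k).1
  have hpos : 0 < ∑' i, R.window (i + k) := by
    have h1 : R.window (0 + k) ≤ ∑' i, R.window (i + k) :=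
      htail.le_tsum 0 (fun j _ => (R.window_pos (j + k)).le)
    have h2 := R.window_pos (0 + k)
    linarith
  unfold windowTimeFrom
  linarith

/-- The Palasek clock of the re-timed window schedule under the clock witness: `T − τ_{k+1} ≤ c₃ / A_k`
(the blow-up time and the readouts shift together, so the witness of `Schedule.ofWindows` serves).
[folklore] -/
theorem T_sub_windowTimeFrom_le_of_clock (hr0 : 0 ≤ r) (hr1 : r < 1)
    (hgeo : ∀ k, R.window (k + 1) ≤ r * R.window k)
    (hclock : ∀ k, R.A k * R.window (k + 1) ≤ (1 - r) * c₃) (k : ℕ) :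
    (τ₀ + ∑' j, R.window j) - windowTimeFrom R τ₀ (k + 1) ≤ c₃ / R.A k := by
  have hs := (window_tail_le hr0 hr1 hgeo 0).1
  simp only [add_zero] at hs
  have hsplit := hs.sum_add_tsum_nat_add (k + 1)
  obtain ⟨_, htail⟩ := window_tail_le hr0 hr1 hgeo (k + 1)
  have hA : 0 < R.A k := R.A_pos k
  have h1r : 0 < 1 - r := by linarith
  have hwk : R.window (k + 1) / (1 - r) ≤ c₃ / R.A k := by
    rw [div_le_div_iff₀ h1r hA]
    have := hclock k
    nlinarith
  unfold windowTimeFrom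
  linarith

end Clock

/-! ## §2 The re-timed window schedule -/

/-- **THE RE-TIMED WINDOW SCHEDULE at the rates `R`**: the rigid window clock started at an ARBITRARY
first readout `τ₀ > 0` (`τ_k = τ₀ + Σ_{j<k} w_j`, `T = τ₀ + Σ_k w_k`, clock witness `c₃`), the registered
constants `c₁ = 1`, `c₂ = 5/3`, `c₅ = 4bβ`, push constant `c₄ = 0`, radius `ρ`, the DATUM `a` (any
rapidly decaying field) and the ZERO force; hypotheses = the register numerics of `R` (`w_{k+1} ≤ r w_k`,
`A_k w_{k+1} ≤ (1 − r)c₃`, `2Y₀ ≤ Y₁`). Label loops and scheduled circulations are constants (the route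
margin does not read them). The `τ₀`-generic twin of `Schedule.ofBoxAt` for UNFORCED designs read at their
own first hitting time. [cite: Palasek2026ElementaryModel, §3.3] -/
def ofWindowsFrom (R : TowerRates) (c₃ r : ℝ) (hr0 : 0 ≤ r) (hr1 : r < 1)
    (hgeo : ∀ k, R.window (k + 1) ≤ r * R.window k)
    (hclock : ∀ k, R.A k * R.window (k + 1) ≤ (1 - r) * c₃) (hsep : 2 * R.Y 0 ≤ R.Y 1)
    (τ₀ : ℝ) (hτ₀ : 0 < τ₀)
    (a : EuclideanSpace ℝ (Fin 3) → EuclideanSpace ℝ (Fin 3)) (ha : HasRapidSpatialDecay a) (ρ : ℝ) :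
    Schedule R where
  T := τ₀ + ∑' k, R.window k
  τ := windowTimeFrom R τ₀
  τ_zero_pos := by rw [windowTimeFrom_zero]; exact hτ₀
  τ_lt_succ := fun k => by
    rw [windowTimeFrom_succ]
    have := R.window_pos k
    linarith
  τ_lt_T := windowTimeFrom_lt_T_of_geo τ₀ hr0 hr1 hgeo
  c₁ := 1
  c₂ := 5 / 3
  c₃ := c₃
  c₄ := 0
  c₅ := 4 * R.b * R.β
  c₁_pos := one_pos
  c₄_le := by norm_num
  c₅_le := le_rfl
  gap := by
    have hY0 : 0 < R.Y 0 := Real.rpow_pos_of_pos (R.N_pos 0) _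
    linarith
  radius := ρ
  clock := T_sub_windowTimeFrom_le_of_clock τ₀ hr0 hr1 hgeo hclock
  u₀ := a
  datum_decay := ha
  f := 0
  force_smooth := by
    have h : uncurry (0 : ℝ → EuclideanSpace ℝ (Fin 3) → EuclideanSpace ℝ (Fin 3)) = fun _ => 0 := by
      funext z; rfl
    show ContDiffOn ℝ ∞ (uncurry (0 : ℝ → EuclideanSpace ℝ (Fin 3) → EuclideanSpace ℝ (Fin 3))) _
    rw [h]
    exact contDiffOn_const
  force_decay := by
    intro n K
    have h : uncurry (0 : ℝ → EuclideanSpace ℝ (Fin 3) → EuclideanSpace ℝ (Fin 3)) = 0 := by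
      funext z; rfl
    refine ⟨0, fun t _ x => ?_⟩
    rw [h, iteratedFDerivWithin_zero]
    simp
  force_silent := fun _ _ _ => rfl
  push_small := by
    intro k t _ x
    show ‖(0 : EuclideanSpace ℝ (Fin 3))‖ ≤ 0 * R.Y k
    simp
  loop := fun _ _ => 0
  loop_smooth := fun _ => contDiff_const
  loop_closed := fun _ => rfl
  Φ := fun _ => 1
  Φ_pos := fun _ => one_pos

/-! ## §3 Field lemmas and the register clauses -/

section OfWindowsFrom

variable {R : TowerRates} {c₃ r : ℝ} (hr0 : 0 ≤ r) (hr1 : r < 1)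
  (hgeo : ∀ k, R.window (k + 1) ≤ r * R.window k)
  (hclock : ∀ k, R.A k * R.window (k + 1) ≤ (1 - r) * c₃) (hsep : 2 * R.Y 0 ≤ R.Y 1)
  {τ₀ : ℝ} (hτ₀ : 0 < τ₀)
  {a : EuclideanSpace ℝ (Fin 3) → EuclideanSpace ℝ (Fin 3)} (ha : HasRapidSpatialDecay a) {ρ : ℝ}

/-- The force of the re-timed window schedule is ZERO. [folklore] -/
theorem ofWindowsFrom_f : (ofWindowsFrom R c₃ r hr0 hr1 hgeo hclock hsep τ₀ hτ₀ a ha ρ).f = 0 := rfl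

/-- The datum of the re-timed window schedule is `a`. [folklore] -/
theorem ofWindowsFrom_u₀ : (ofWindowsFrom R c₃ r hr0 hr1 hgeo hclock hsep τ₀ hτ₀ a ha ρ).u₀ = a := rfl

/-- The readouts of the re-timed window schedule. [folklore] -/
theorem ofWindowsFrom_τ :
    (ofWindowsFrom R c₃ r hr0 hr1 hgeo hclock hsep τ₀ hτ₀ a ha ρ).τ = windowTimeFrom R τ₀ := rfl

/-- `τ 0 = τ₀`. [folklore] -/
theorem ofWindowsFrom_τ_zero : (ofWindowsFrom R c₃ r hr0 hr1 hgeo hclock hsep τ₀ hτ₀ a ha ρ).τ 0 = τ₀ :=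
  windowTimeFrom_zero R τ₀

/-- `τ 1 = τ₀ + w₀`. [folklore] -/
theorem ofWindowsFrom_τ_one :
    (ofWindowsFrom R c₃ r hr0 hr1 hgeo hclock hsep τ₀ hτ₀ a ha ρ).τ 1 = τ₀ + R.window 0 :=
  windowTimeFrom_one R τ₀

/-- The blow-up time of the re-timed window schedule. [folklore] -/
theorem ofWindowsFrom_T :
    (ofWindowsFrom R c₃ r hr0 hr1 hgeo hclock hsep τ₀ hτ₀ a ha ρ).T = τ₀ + ∑' k, R.window k := rfl

/-- The radius of the re-timed window schedule is `ρ`. [folklore] -/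
theorem ofWindowsFrom_radius : (ofWindowsFrom R c₃ r hr0 hr1 hgeo hclock hsep τ₀ hτ₀ a ha ρ).radius = ρ :=
  rfl

/-- `c₁ = 1`. [folklore] -/
theorem ofWindowsFrom_c₁ : (ofWindowsFrom R c₃ r hr0 hr1 hgeo hclock hsep τ₀ hτ₀ a ha ρ).c₁ = 1 := rfl

/-- `c₂ = 5/3`. [folklore] -/
theorem ofWindowsFrom_c₂ : (ofWindowsFrom R c₃ r hr0 hr1 hgeo hclock hsep τ₀ hτ₀ a ha ρ).c₂ = 5 / 3 := rfl

/-- `c₄ = 0`. [folklore] -/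
theorem ofWindowsFrom_c₄ : (ofWindowsFrom R c₃ r hr0 hr1 hgeo hclock hsep τ₀ hτ₀ a ha ρ).c₄ = 0 := rfl

/-- `c₅ = 4bβ`. [folklore] -/
theorem ofWindowsFrom_c₅ :
    (ofWindowsFrom R c₃ r hr0 hr1 hgeo hclock hsep τ₀ hτ₀ a ha ρ).c₅ = 4 * R.b * R.β := rfl

/-- **The quiet read-back time of level `1` is the first readout**: `τ₁ − c₅ log N₁ / A₀ = τ₀`
(window equality at `k = 0`). [folklore] -/
theorem ofWindowsFrom_τ_one_sub_window :
    (ofWindowsFrom R c₃ r hr0 hr1 hgeo hclock hsep τ₀ hτ₀ a ha ρ).τ 1 -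
        (ofWindowsFrom R c₃ r hr0 hr1 hgeo hclock hsep τ₀ hτ₀ a ha ρ).c₅ * Real.log (R.N 1) / R.A 0 =
      τ₀ := by
  rw [ofWindowsFrom_τ_one, ofWindowsFrom_c₅]
  unfold TowerRates.window
  ring

/-- **RIGID** (window equality, `c₅ = 4bβ`, `c₁ = 1`, `c₂ = 5/3` — by construction). [folklore] -/
theorem ofWindowsFrom_rigid : (ofWindowsFrom R c₃ r hr0 hr1 hgeo hclock hsep τ₀ hτ₀ a ha ρ).Rigid where
  window_eq := fun k => by
    show windowTimeFrom R τ₀ (k + 1) = windowTimeFrom R τ₀ k + 4 * R.b * R.β * Real.log (R.N (k + 1)) / R.A k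
    rw [windowTimeFrom_succ]
    rfl
  c₅_eq := rfl
  c₁_eq := rfl
  c₂_eq := rfl

/-- **QUIET** (the force is identically zero). [folklore] -/
theorem ofWindowsFrom_quiet : (ofWindowsFrom R c₃ r hr0 hr1 hgeo hclock hsep τ₀ hτ₀ a ha ρ).Quiet :=
  Quiet.of_force_eq_zero fun _ => rfl

/-- **PINNED with every impulse dial `Λ` and `θ = 6/5`** as soon as the datum is confined to `B̄(0, ρ)`
and the rates afford the band `2Y_k ≤ Y_{k+1}` at every level (the force is zero: the impulse pin is
free and the force is trivially confined). [folklore] -/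
theorem ofWindowsFrom_pins (hsep' : ∀ k, 2 * R.Y k ≤ R.Y (k + 1)) (haρ : ∀ x, ρ < ‖x‖ → a x = 0)
    (Λ : ℝ) : (ofWindowsFrom R c₃ r hr0 hr1 hgeo hclock hsep τ₀ hτ₀ a ha ρ).Pins Λ (6 / 5) where
  impulse := fun k => by
    show Λ * (0 * R.Y k) * _ ≤ 1 * R.Y (k + 1) - 5 / 3 * R.Y k
    have := hsep' k
    have hY : 0 < R.Y k := Real.rpow_pos_of_pos (R.N_pos k) _
    simp only [zero_mul, mul_zero]
    linarith
  sep := fun k => by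
    show 6 / 5 * (5 / 3 * R.Y k) ≤ 1 * R.Y (k + 1)
    have := hsep' k
    linarith
  datum_confined := fun x hx => haρ x hx
  force_confined := fun _ _ _ => rfl

/-- The readouts of the re-timed schedule dominate `τ₀`. [folklore] -/
theorem le_ofWindowsFrom_τ (k : ℕ) : τ₀ ≤ (ofWindowsFrom R c₃ r hr0 hr1 hgeo hclock hsep τ₀ hτ₀ a ha ρ).τ k := by
  have h := windowTimeFrom_mono R τ₀ (Nat.zero_le k)
  rw [windowTimeFrom_zero] at h
  exact h

end OfWindowsFrom

/-! ## §4 The tuned instance -/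

section Tuned

variable {τ₀ : ℝ} (hτ₀ : 0 < τ₀) {a : EuclideanSpace ℝ (Fin 3) → EuclideanSpace ℝ (Fin 3)}
  (ha : HasRapidSpatialDecay a) {ρ : ℝ}

/-- **THE RE-TIMED WINDOW SCHEDULE ON THE TUNED RATES** (`c₃ = 128`, `r = 1/3`; numerics
`tuned_window_geo`, `tuned_window_clock`, `tuned_sep`). [cite: Palasek2026ElementaryModel, §3.3] -/
def ofWindowsFromTuned (τ₀ : ℝ) (hτ₀ : 0 < τ₀) (a : EuclideanSpace ℝ (Fin 3) → EuclideanSpace ℝ (Fin 3))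
    (ha : HasRapidSpatialDecay a) (ρ : ℝ) : Schedule TowerRates.tuned :=
  ofWindowsFrom TowerRates.tuned 128 (1 / 3) (by norm_num) (by norm_num) TowerRates.tuned_window_geo
    TowerRates.tuned_window_clock (TowerRates.tuned_sep 0) τ₀ hτ₀ a ha ρ

/-- Field lemmas of the tuned re-timed schedule: force, datum, first two readouts, radius. [folklore] -/
theorem ofWindowsFromTuned_fields :
    (ofWindowsFromTuned τ₀ hτ₀ a ha ρ).f = 0 ∧ (ofWindowsFromTuned τ₀ hτ₀ a ha ρ).u₀ = a ∧
    (ofWindowsFromTuned τ₀ hτ₀ a ha ρ).τ 0 = τ₀ ∧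
    (ofWindowsFromTuned τ₀ hτ₀ a ha ρ).τ 1 = τ₀ + TowerRates.tuned.window 0 ∧
    (ofWindowsFromTuned τ₀ hτ₀ a ha ρ).radius = ρ :=
  ⟨rfl, rfl, windowTimeFrom_zero _ _, windowTimeFrom_one _ _, rfl⟩

/-- The tuned re-timed schedule is RIGID and QUIET, and PINNED with `Λ = 8`, `θ = 6/5` once the datum is
confined to `B̄(0, ρ)`. [folklore] -/
theorem ofWindowsFromTuned_register (haρ : ∀ x, ρ < ‖x‖ → a x = 0) :
    (ofWindowsFromTuned τ₀ hτ₀ a ha ρ).Rigid ∧ (ofWindowsFromTuned τ₀ hτ₀ a ha ρ).Quiet ∧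
    (ofWindowsFromTuned τ₀ hτ₀ a ha ρ).Pins 8 (6 / 5) :=
  ⟨ofWindowsFrom_rigid _ _ _ _ _ hτ₀ ha, ofWindowsFrom_quiet _ _ _ _ _ hτ₀ ha,
    ofWindowsFrom_pins _ _ _ _ _ hτ₀ ha TowerRates.tuned_sep haρ 8⟩

end Tuned

end Schedule

end Summit.NavierStokesRegularity.FluidComputer.PalasekTowerClayBridge

end
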